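import Mathlib

/-!
# Entropy transport at jet level for a general athermal law — stub `stub_entropyTransportZ`

Crux `Summit.AtomisticToContinuum.HydrodynamicLimit.Theses.ImplosionDichotomy.DenseExcursion`
(stmt-AtomisticToContinuum-12586), line `r2-one-mode-two-conditions` (skeleton v8d), registered stub
`stub_entropyTransportZ : EntropyTransportZ` (definition verbatim from the skeleton, §0).

**Mathematics.** Along the `pf`- and `tf`-equations of the radial reduction without heating and with
compressibility factor `Z = 1 + η̂ F′(η̂)` at the local packing `η̂ = pf·δ`, the hard-sphere entropy in
self-similar radial variables `κ = (3/2) log tf − log pf − F(pf δ) + 3x` is purely transported,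
`κ_τ = (w − 1) κ_x`. Cleared of logarithms and chain rules this is a polynomial identity in the twelve real
jet variables `r, δ, Fp, Z, pf, pf′, pfτ, w, w′, tf, tf′, tfτ` that follows from the three defining relations
(for `Z`, `pfτ`, `tfτ`) by substitution: explicitly
`LHS − RHS = (3/2)·pf·(tfτ − …) − (tf + pf·tf·Fp·δ)·(pfτ − …)` modulo the relation for `Z`, and after
substituting all three relations both sides agree as polynomials (`ring`). At `δ = 0` (`Z = 1`) it reduces to
the ideal-gas identity `entropy_transport_jet` of the skeleton. Elementary algebra; no cited facts.
-/

noncomputable section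

open Set Filter Topology
open scoped ContDiff

namespace Summit.AtomisticToContinuum.HydrodynamicLimit.Theorems.R2OneModeTwoConditions

/-! ## The statement (verbatim: skeleton §0) -/

/-- ENTROPY TRANSPORT AT JET LEVEL FOR A GENERAL ATHERMAL LAW (blueprint §7, the entropy sector): along the `pf`- and `tf`-equations of
`RadialReductionD` without heating (`H = 0`) and with `Z = 1 + η̂ F′(η̂)` at the local packing `η̂ = pf·δ` (`δ = D³`, `δ_τ = 3(r−1)δ`), the
hard-sphere entropy in self-similar radial variables `κ = (3/2) log tf − log pf − F(pf δ) + 3x` is purely TRANSPORTED,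
`κ_τ = (w − 1) κ_x`; written without logarithms / chain rules (`Fp` stands for `F′(pf δ)`, `pfτ, tfτ, pf′, tf′` for the jet):
`(3/2) pf tfτ − tf pfτ − pf tf Fp (δ pfτ + 3(r−1) δ pf) = (w−1) ((3/2) pf tf′ − tf pf′ − pf tf Fp δ pf′ + 3 pf tf)`. At `δ = 0` this is
the landed ideal identity `entropy_transport_jet`. -/
def EntropyTransportZ : Prop :=
  ∀ (r δ Fp Z pf pf' pfτ w w' tf tf' tfτ : ℝ),
    Z = 1 + pf * δ * Fp →
    pfτ = (w - 1) * pf' + pf * (w' + 3 * w + 3 - 3 * r) →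
    tfτ = (w - 1) * tf' + 2 / 3 * Z * tf * w' + tf * (2 * w - 2 * r + 2 * w * Z) →
    3 / 2 * pf * tfτ - tf * pfτ - pf * tf * Fp * (δ * pfτ + 3 * (r - 1) * δ * pf) =
      (w - 1) * (3 / 2 * pf * tf' - tf * pf' - pf * tf * Fp * δ * pf' + 3 * pf * tf)

/-! ## The identity -/

/-- **ENTROPY TRANSPORT AT JET LEVEL FOR A GENERAL ATHERMAL LAW** (stub `stub_entropyTransportZ`): the polynomial
identity `(3/2) pf tfτ − tf pfτ − pf tf Fp (δ pfτ + 3(r−1) δ pf) = (w−1) ((3/2) pf tf′ − tf pf′ − pf tf Fp δ pf′ + 3 pf tf)`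
under the jet relations `Z = 1 + pf δ Fp`, `pfτ = (w−1) pf′ + pf (w′ + 3w + 3 − 3r)`,
`tfτ = (w−1) tf′ + (2/3) Z tf w′ + tf (2w − 2r + 2wZ)`. Proof: substitute the three relations and close by `ring`.
[folklore] -/
theorem stub_entropyTransportZ : EntropyTransportZ := by
  intro r δ Fp Z pf pf' pfτ w w' tf tf' tfτ hZ hpf htf
  subst hZ hpf htf
  ring

end Summit.AtomisticToContinuum.HydrodynamicLimit.Theorems.R2OneModeTwoConditions

end
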